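import Mathlib
import HarnessLib
import Summits.HubbardSuperconductivity.HubbardSuperconductivity.Theses.ComplexGFFStiffness
import Summits.HubbardSuperconductivity.HubbardSuperconductivity.Theorems.ComplexGFFStiffnessTwoKernelNextKStepLoc
import Summits.HubbardSuperconductivity.HubbardSuperconductivity.Theorems.ComplexGFFStiffnessTwoKernelSkBoundRawReduction
import Summits.HubbardSuperconductivity.HubbardSuperconductivity.Theorems.ComplexGFFStiffnessTwoKernelSkBoundFarField

/-!
# Crux child `TwoKernelSkBound` (stmt-HubbardSuperconductivity-27414): the FIRST-ORDER conjunct holds unconditionally,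
# and the crux child is closed modulo the registered stub `stub_f4l2ShrinkLoc`

Route `route-HubbardSuperconductivity-ComplexGFFStiffness`, cruxes stmt-…-19154 `HypACumulant` / stmt-…-19155
`HypALocalTwoPoint`, line `Cruxes/HypACumulant/Lines/banach_two_kernel.lean`.  Composing the landed stubs 1, 1b, 3a
(`stub_twoKernelNextKStepLoc` p830855, `stub_twoKernelSkBoundLoc_of_raw` p827477, `stub_twoKernelSkBound_of_loc` p826914):

* **`twoKernelSkBound_dim (d)`** / **`twoKernelSkBound_four`** — `GradientRG.TwoKernelSkBound d` for every `d` (the `N`-FREE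
  two-kernel comparison of the [ABKM19] RG step `S_k` in the tuning parameter, (12.53) at `ℓ = 1`, slot (F4l) for every package at
  every height) — the first conjunct of the crux child, UNCONDITIONALLY;
* `f4l2Shrink_of_shrinkLoc` — the second conjunct `F4l2Shrink 4` from the one open stub `F4l2ShrinkLoc 4` (stub 3b, p826914);
* **`TwoKernelSkBound_of_f4l2ShrinkLoc`** — the crux child BY NAME from `F4l2ShrinkLoc 4` alone.

Honest framing: rung route (stiffness of a complex Gaussian gradient field via the [ABKM19] RG); nothing here is about
superconductivity in the Hubbard model; the crux child itself stays OPEN (its `ℓ = 2` conjunct hinges on `stub_f4l2ShrinkLoc`,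
plan in `Cruxes/HypACumulant/TWOKERNEL-PLAN-27414-v2.md` §9–§10).
-/

noncomputable section

set_option linter.dupNamespace false

namespace Summit.HubbardSuperconductivity.HubbardSuperconductivity.Theorems.ComplexGFF

open Literature.MathematicalPhysics.StatisticalMechanics.GradientRG
  (TwoKernelSkBound F4l2Shrink TwoKernelSkBoundLoc F4l2ShrinkLoc TwoKernelNextKStepLoc)

/-- **`TwoKernelSkBound d` holds for every `d`**: for every [ABKM19] package an `N`-free size `l_T` with the slot (F4l)
(`‖S_k^{(q)}(u,v) − S_k^{(q')}(u,v)‖_{k+1} ≤ l_T |q − q'|₁ max(‖u‖, ‖v‖_k)` on the ball) at every height — local bound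
(`twoKernelNextKStepLoc_all`, `twoKernelSkBoundLoc_of_raw`) plus the far field (`twoKernelSkBound_of_loc`).
[cite: AdamsBuchholzKoteckyMuller2019, Lemma 12.6 (12.53) / Theorem 6.8] -/
theorem twoKernelSkBound_dim (d : ℕ) : TwoKernelSkBound d :=
  twoKernelSkBound_of_loc (twoKernelSkBoundLoc_of_raw (twoKernelNextKStepLoc_all d))

/-- **The first conjunct of the crux child `TwoKernelSkBound`: `GradientRG.TwoKernelSkBound 4`** (stubs 1, 1b, 3a of the line,
all landed). [cite: AdamsBuchholzKoteckyMuller2019, Lemma 12.6 (12.53) / Theorem 6.8] -/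
theorem twoKernelSkBound_four : TwoKernelSkBound 4 :=
  stub_twoKernelSkBound_of_loc (stub_twoKernelSkBoundLoc_of_raw stub_twoKernelNextKStepLoc)

/-- The second conjunct from the open stub: `F4l2ShrinkLoc 4 → F4l2Shrink 4` (stub 3b with the first conjunct supplied).
[cite: AdamsBuchholzKoteckyMuller2019, Lemma 12.6 (12.53), ℓ = 2] -/
theorem f4l2Shrink_of_shrinkLoc (h : F4l2ShrinkLoc 4) : F4l2Shrink 4 :=
  stub_f4l2Shrink_of_loc twoKernelSkBound_four h

/-- **The crux child BY NAME, modulo the last open stub**: `F4l2ShrinkLoc 4 → TwoKernelSkBound` (the route declaration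
`Summit.….Theses.ComplexGFFStiffness.TwoKernelSkBound := GradientRG.TwoKernelSkBound 4 ∧ GradientRG.F4l2Shrink 4`).
[cite: AdamsBuchholzKoteckyMuller2019, Lemma 12.6 (12.53)] -/
theorem TwoKernelSkBound_of_f4l2ShrinkLoc (h : F4l2ShrinkLoc 4) :
    Summit.HubbardSuperconductivity.HubbardSuperconductivity.Theses.ComplexGFFStiffness.TwoKernelSkBound :=
  ⟨twoKernelSkBound_four, f4l2Shrink_of_shrinkLoc h⟩

end Summit.HubbardSuperconductivity.HubbardSuperconductivity.Theorems.ComplexGFF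

end
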